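import Mathlib.RingTheory.MvPolynomial.Homogeneous
import Mathlib.RingTheory.Ideal.Quotient.Basic
import Mathlib.FieldTheory.Perfect
import Mathlib.LinearAlgebra.LinearIndependent.Defs
import HarnessLib

/-!
# Crux `Steer` (stmt-ResolutionOfSingularities-16345), chain W4.1 — NRA at A-stage windows: the BI-CONE WORDS `BiCone`, `BiConeQuadratic`
# (res-L0-w41-strat-2 g4's `NRA/BiCone_sketch_v2.lean` ec6f32d705514353, the two `def … : Prop` bodies VERBATIM; filed by the BiCone hand
# res-D-pv-053 g9 per res-L0-w41-plan-1 RULING 286 (d) / 288 so that `biCone_holds` and res-D-repro-2's run reading consume the word BY NAME)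

OURS; candidates, not facts; pure commutative algebra over a PERFECT field (only the separability of `κ(𝔮)/k` is used), characteristic-free.
Nothing here is a statement of H. Hironakaʼs manuscript [Hironaka2017] (status: under review); AI-written, AI review weaker than expert review.
A polynomial `g` of total degree `≤ d` lying in the `d`-th power of a NON-RATIONAL maximal ideal `𝔮 ⊂ k[T₁,…,T_n]` vanishes to order `d` at
`r ≥ 2` distinct geometric points, hence is a CONE over the (k-rational) affine span of the conjugates: `g = H(λ₁,…,λ_m)` with `λ_i` affine-linear,
vanishing at `𝔮`, linearly independent linear parts, `m < n`, and `H` a FORM of degree `d`. For `n = 3`: `m ≤ 2` — the initial form at a late A-stage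
followed by a residually non-rational window is BINARY and ON-AXIS (hH2′ʼs datum at that A-stage), except in the UNIAXIAL sub-case `m = 1`.
(folklore)
-/


set_option linter.dupNamespace false

namespace Summit.ResolutionOfSingularities.ResolutionOfSingularities.Theorems.SwitchingDichotomy.NonRationalWindow

/-- **W-BC · BiCone.** See the module docstring. (Proof route: over the normal closure `k′` of `κ(𝔮)`, `𝔮 k′[T] = ⋂_σ 𝔮_σ` (separable), so
`g ∈ 𝔮_σ^d` at each conjugate point `τ_σ`; `g(τ_σ + T)` has order `≥ d ≥ deg`, hence is homogeneous of degree `d`; two vertices `τ₁ ≠ τ₂` force all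
Hasse derivatives of `g(τ₁ + T)` in the direction `w = τ₂ − τ₁` to vanish, i.e. `g(τ₁ + T + C·w) = g(τ₁ + T)` identically; the span `V` of the
differences of conjugates is Galois-stable, so descends to `k`, and `λ(τ₁) ∈ k` for every `k`-linear form `λ` vanishing on `V` (it is constant on the
Galois orbit); `g ∈ k[λ₁,…,λ_m]` re-expanded at the `k`-point `λ(τ₁)` is a form of degree `d`.) OURS. (folklore) -/
def BiCone : Prop :=
  ∀ (k : Type) [Field k] [PerfectField k] (n : ℕ) (𝔮 : Ideal (MvPolynomial (Fin n) k)) [𝔮.IsMaximal],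
    ¬ Function.Surjective (algebraMap k (MvPolynomial (Fin n) k ⧸ 𝔮)) →
    ∀ (g : MvPolynomial (Fin n) k) (d : ℕ), g.totalDegree ≤ d → g ∈ 𝔮 ^ d →
      ∃ (m : ℕ) (lam : Fin m → MvPolynomial (Fin n) k) (H : MvPolynomial (Fin m) k),
        m < n ∧ (∀ i, (lam i).totalDegree ≤ 1 ∧ lam i ∈ 𝔮) ∧
        LinearIndependent k (fun i => lam i - MvPolynomial.C ((lam i).coeff 0)) ∧
        H.IsHomogeneous d ∧ g = MvPolynomial.aeval lam H

/-- **W-BC₂ · the quadratic window always carries TWO independent on-axis rational forms**: if moreover `[κ(𝔮) : k] = 2` (two conjugate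
points span a LINE), then `m = n − 1` independent affine-linear forms vanishing at `𝔮` exist and `g` is a form in them (for `n = 3`: two
forms — enough for hH2ʼs binary datum, whose `Ψ` MAY be degenerate: `g = λ₂^d` with `𝔮 = (T₁²+T₁+1, T₂, T₃)`, `k = 𝔽₂` is allowed and is
NOT uniaxial in the sense of W-NRA-U, since a second independent on-axis rational form exists; res-L0-w41-tri-1 v6.45 caveat). OURS. (folklore) -/
def BiConeQuadratic : Prop :=
  ∀ (k : Type) [Field k] [PerfectField k] (n : ℕ) (𝔮 : Ideal (MvPolynomial (Fin n) k)) [𝔮.IsMaximal],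
    Module.finrank k (MvPolynomial (Fin n) k ⧸ 𝔮) = 2 →
    ∀ (g : MvPolynomial (Fin n) k) (d : ℕ), g.totalDegree ≤ d → g ∈ 𝔮 ^ d →
      ∃ (lam : Fin (n - 1) → MvPolynomial (Fin n) k) (H : MvPolynomial (Fin (n - 1)) k),
        (∀ i, (lam i).totalDegree ≤ 1 ∧ lam i ∈ 𝔮) ∧
        LinearIndependent k (fun i => lam i - MvPolynomial.C ((lam i).coeff 0)) ∧
        H.IsHomogeneous d ∧ g = MvPolynomial.aeval lam H

end Summit.ResolutionOfSingularities.ResolutionOfSingularities.Theorems.SwitchingDichotomy.NonRationalWindow
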